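import Summits.BirchSwinnertonDyer.BirchSwinnertonDyer.Theses.CumulativeHeegnerLeopoldt
import Summits.BirchSwinnertonDyer.BirchSwinnertonDyer.Theorems.CumulativeHeegnerLeopoldtCumulativeHeegnerInclusionAtThreeB1OfPrint
import Summits.BirchSwinnertonDyer.BirchSwinnertonDyer.Theorems.CumulativeHeegnerLeopoldtCumulativeHeegnerInclusionAtThreeLineDeterminantAtThree
import Summits.BirchSwinnertonDyer.BirchSwinnertonDyer.Theorems.CumulativeHeegnerLeopoldtCumulativeHeegnerInclusionAtThreeBadPlacesSplitFinite
import HarnessLib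

/-!
# Route `CumulativeHeegnerLeopoldt` (rev 5) — support item B1P `ResidualSelmerFiniteAtThreeOfPrint`
# (stmt-BirchSwinnertonDyer-26898): stub B1 of line `birth` FROM THE PRINT INPUT P, PROVED

Lead prover bsd-line-chl-k1-p1 g2 (`--workitem stmt-BirchSwinnertonDyer-26898`). B1P := P → B1, where P =
`ResidualSelmerPrintedInputAtThree` is BY DEFINITION the Literature named fact
`CastellaGrossiLeeSkinner2022.prop14_residualCharacterSelmer_finite` (CGLS22 §1.2 Prop. 14; Rubin 1991 + Hida 2010)
and B1 = «`Sel_{𝔭′}(K_∞, E[3^∞])[3]` finite on the Leopoldt cell» verbatim. Proof =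
`…B1OfPrint.stub_residualSelmerFinite_of_print` (p613183: residual devissage along the rational line p609974, Kummer
step, degree-one transport of the non-anomalous clause p611257, no fixed vectors up the ℤ₃-tower p611775, Brink)
with its two kernel-size inputs discharged: det on a stable line (p614633; also -w2's p614784) and the split bad
places (p613929). P stays a displayed antecedent (print). BSD is not proved by any of this.
-/

-- `…BirchSwinnertonDyer.BirchSwinnertonDyer.Theorems…` is the problem's mandated namespace (D-0017).
set_option linter.dupNamespace false

namespace Summit.BirchSwinnertonDyer.BirchSwinnertonDyer.Theorems

/-- **B1P PROVED**: `ResidualSelmerPrintedInputAtThree → (stub B1 verbatim)` — CGLS22 Prop. 14 for the two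
characters of `E[3]^{ss}` over the Heegner field, the residual devissage along the rational line, the Kummer step,
Brink's finite decomposition of `𝔭′`, the degree-one transport of the non-anomalous clause, the Weil-pairing
determinant on the line (`φψ = ω`) and the split bad places.
[cite: CastellaGrossiLeeSkinner2022, §1 Props. 14, 17, 18 (arXiv:2008.02571)] [cite: Brink2007, Cor. 1] -/
theorem cumulativeHeegnerLeopoldt_residualSelmerFiniteAtThreeOfPrint_proof :
    Summit.BirchSwinnertonDyer.BirchSwinnertonDyer.Theses.CumulativeHeegnerLeopoldt.ResidualSelmerFiniteAtThreeOfPrint :=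
  fun hP ↦
    CumulativeHeegnerInclusionAtThreeB1OfPrint.stub_residualSelmerFinite_of_print hP
      CumulativeHeegnerInclusionAtThreeLineDet.stub_lineDeterminantAtThree
      CumulativeHeegnerInclusionAtThreeBadPlaces.stub_badPlacesSplitFinite

end Summit.BirchSwinnertonDyer.BirchSwinnertonDyer.Theorems
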